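/-
Copyright: the b2b-balaban cell (near-miss cell 7), T⁴-continuum fan-out; row NE7b ROUND-2 swarm, seat
t4-ne7b-formalise-leaf-03 (gen 2) (row S12 «ASSEMBLY» of `t4/b2b-balaban-t4-ne7b-p1/LEAVES-NE7b.md`; node A12-I of
the typer's `t4/formal/NE7b/DAG.md`).  Released under the licence of the surrounding project.
-/
import Mathlib

/-!
# The transversal lemma: a sum over slot-transversal families of a product is below the product of the slot sums

Summits-side support file of the T⁴-continuum cell (rung (B)+1 on a FINITE torus only; NOT infinite volume, NOT the
mass gap, NOT the Clay statement; NOT a proof of the spine estimate NE7b).  Row S12 «ASSEMBLY» of the ROUND-2 swarm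
table `t4/b2b-balaban-t4-ne7b-p1/LEAVES-NE7b.md`, node A12-I of the typer's `t4/formal/NE7b/DAG.md`; Mathlib only.
The one combinatorial step of the multiplicity-keyed assembly layer `HistoryAssemblyMult`: the PLACEMENT sum of the
NE7b COUNT road — over all member families occupying a given family of tree slots — is dominated slot by slot.

WHAT.  **`sum_prod_le_prod_sum`**: for `slot : β → σ`, `occ : σ → Finset β`, a price `p ≥ 0`, a finite slot set `c`
and a finite set `M` of finite families `m ⊆ β`, each with pairwise distinct slots (`Set.InjOn slot m`), slot set
exactly `c` (`m.image slot = c`) and every member an occupant of its slot (`q ∈ occ (slot q)`):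
`Σ_{m ∈ M} ∏_{q ∈ m} p q ≤ ∏_{s ∈ c} Σ_{q ∈ occ s} p q`.  Proof by induction on `c`: split off the unique member at the
new slot, group the families by it, erase it injectively, apply the hypothesis to the erased families, and expand
`∏_{insert a c} = (Σ_{occ a}) · ∏_c`.  [folklore] elementary finite combinatorics; no definition, no `[cite:]` tag.

HONEST DEPENDENCY (cell): continuum YM on T⁴ ⇐ BetaPertH ∧ nine spine estimates (0/9 proved); BetaPertH ⇐ (D1) ∧ (D4)
∧ CAP+tail.  Nothing of H3 ∕ (B) ∕ BetaPertH is touched here; NE7b is NOT proved; no date.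
-/

open Finset

namespace Summit.QuantumFields.BalabanUV.T4Continuum.HistoryTransversal

section Transversal

variable {β σ : Type*} [DecidableEq β] [DecidableEq σ]

/-- **SUM OVER TRANSVERSAL FAMILIES ≤ PRODUCT OF SLOT SUMS.**  Let `slot : β → σ`, `occ : σ → Finset β`, `p ≥ 0`.  For
a finite set `M` of finite families `m ⊆ β`, each with pairwise distinct slots, slot set exactly `c`, and every member an
occupant of its slot (`q ∈ occ (slot q)`):  `Σ_{m ∈ M} ∏_{q ∈ m} p q ≤ ∏_{s ∈ c} Σ_{q ∈ occ s} p q`.  (Induction on `c`: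
split off the unique member at the new slot, erase it injectively, expand the product.) [folklore] -/
theorem sum_prod_le_prod_sum (slot : β → σ) (occ : σ → Finset β) (p : β → ℝ) (hp : ∀ q, 0 ≤ p q) (c : Finset σ) :
    ∀ M : Finset (Finset β), (∀ m ∈ M, Set.InjOn slot (m : Set β)) → (∀ m ∈ M, m.image slot = c) →
      (∀ m ∈ M, ∀ q ∈ m, q ∈ occ (slot q)) →
      ∑ m ∈ M, ∏ q ∈ m, p q ≤ ∏ s ∈ c, ∑ q ∈ occ s, p q := by
  classical
  refine Finset.induction_on c ?_ ?_
  · intro M _ hsl _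
    have hM : ∀ m ∈ M, m = ∅ := fun m hm => image_eq_empty.1 (hsl m hm)
    have hsub : M ⊆ {∅} := fun m hm => mem_singleton.2 (hM m hm)
    calc ∑ m ∈ M, ∏ q ∈ m, p q = ∑ m ∈ M, (1 : ℝ) :=
          sum_congr rfl fun m hm => by rw [hM m hm, prod_empty]
      _ = (M.card : ℝ) := by rw [sum_const, nsmul_eq_mul, mul_one]
      _ ≤ 1 := by exact_mod_cast (card_le_card hsub).trans (card_singleton _).le
      _ = ∏ s ∈ (∅ : Finset σ), ∑ q ∈ occ s, p q := prod_empty.symm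
  · intro a c ha ih M hinj hsl hocc
    have hPc : 0 ≤ ∏ s ∈ c, ∑ q ∈ occ s, p q := prod_nonneg fun s _ => sum_nonneg fun q _ => hp q
    -- every family has exactly one member at the new slot `a`
    have hex : ∀ m ∈ M, ∃ q ∈ m, slot q = a := fun m hm => by
      have h : a ∈ m.image slot := by rw [hsl m hm]; exact mem_insert_self a c
      simpa only [mem_image] using h
    have hpick : ∀ m ∈ M, ∀ q ∈ m, slot q = a → m.filter (fun q' => slot q' = a) = {q} := by
      intro m hm q hq hqa
      ext q'
      simp only [mem_filter, mem_singleton]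
      constructor
      · rintro ⟨hq', hq'a⟩
        exact hinj m hm (Finset.mem_coe.2 hq') (Finset.mem_coe.2 hq) (hq'a.trans hqa.symm)
      · rintro rfl
        exact ⟨hq, hqa⟩
    have hmaps : ∀ m ∈ M, m.filter (fun q' => slot q' = a) ∈ (occ a).image fun q => ({q} : Finset β) := by
      intro m hm
      obtain ⟨q, hq, hqa⟩ := hex m hm
      exact mem_image.2 ⟨q, hqa ▸ hocc m hm q hq, (hpick m hm q hq hqa).symm⟩
    rw [← sum_fiberwise_of_maps_to hmaps, sum_image (singleton_injective.injOn), prod_insert ha, sum_mul]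
    refine sum_le_sum fun q _ => ?_
    show ∑ m ∈ M.filter (fun m => m.filter (fun q' => slot q' = a) = {q}), ∏ q' ∈ m, p q' ≤
      p q * ∏ s ∈ c, ∑ q' ∈ occ s, p q'
    set Mq := M.filter (fun m => m.filter (fun q' => slot q' = a) = {q}) with hMq
    have hq_of : ∀ m ∈ Mq, m ∈ M ∧ q ∈ m ∧ slot q = a := by
      intro m hm
      obtain ⟨hmM, hpm⟩ := mem_filter.1 hm
      have h : q ∈ m.filter fun q' => slot q' = a := by rw [hpm]; exact mem_singleton_self q
      exact ⟨hmM, (mem_filter.1 h).1, (mem_filter.1 h).2⟩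
    -- split off the factor `p q`
    have hsplit : ∑ m ∈ Mq, ∏ q' ∈ m, p q' = p q * ∑ m ∈ Mq, ∏ q' ∈ m.erase q, p q' := by
      rw [mul_sum]
      exact sum_congr rfl fun m hm => (mul_prod_erase m p (hq_of m hm).2.1).symm
    rw [hsplit]
    refine mul_le_mul_of_nonneg_left ?_ (hp q)
    -- erase `q` injectively and apply the induction hypothesis to the erased families
    have herase : Set.InjOn (fun m : Finset β => m.erase q) (Mq : Set (Finset β)) := by
      intro m₁ h₁ m₂ h₂ h
      have e₁ := insert_erase (hq_of m₁ (Finset.mem_coe.1 h₁)).2.1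
      have e₂ := insert_erase (hq_of m₂ (Finset.mem_coe.1 h₂)).2.1
      have h' : m₁.erase q = m₂.erase q := h
      rw [← e₁, ← e₂, h']
    have hre : ∑ m' ∈ Mq.image (fun m => m.erase q), ∏ q' ∈ m', p q' = ∑ m ∈ Mq, ∏ q' ∈ m.erase q, p q' :=
      sum_image herase
    rw [← hre]
    refine ih _ ?_ ?_ ?_
    · intro m' hm'
      obtain ⟨m, hm, rfl⟩ := mem_image.1 hm'
      exact (hinj m (hq_of m hm).1).mono (Finset.coe_subset.2 (erase_subset q m))
    · intro m' hm'
      obtain ⟨m, hm, rfl⟩ := mem_image.1 hm'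
      obtain ⟨hmM, hqm, hqa⟩ := hq_of m hm
      ext x
      simp only [mem_image, mem_erase]
      constructor
      · rintro ⟨q', ⟨hne, hq'⟩, rfl⟩
        have hx : slot q' ∈ insert a c := by rw [← hsl m hmM]; exact mem_image_of_mem slot hq'
        rcases mem_insert.1 hx with hxa | hxc
        · exact absurd (hinj m hmM (Finset.mem_coe.2 hq') (Finset.mem_coe.2 hqm) (hxa.trans hqa.symm)) hne
        · exact hxc
      · intro hxc
        have hx : x ∈ m.image slot := by rw [hsl m hmM]; exact mem_insert_of_mem hxc
        obtain ⟨q', hq', rfl⟩ := mem_image.1 hx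
        refine ⟨q', ⟨?_, hq'⟩, rfl⟩
        rintro rfl
        exact ha (hqa ▸ hxc)
    · intro m' hm' q' hq'
      obtain ⟨m, hm, rfl⟩ := mem_image.1 hm'
      exact hocc m (hq_of m hm).1 q' (mem_of_mem_erase hq')

end Transversal

end Summit.QuantumFields.BalabanUV.T4Continuum.HistoryTransversal
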